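import Summits.ValiantsHypothesis.ValiantsHypothesis.Theses.GeneratorObstructions
import Summits.ValiantsHypothesis.ValiantsHypothesis.Theorems.GeneratorObstructionsGenInheritance

/-!
# Route GeneratorObstructions — support item `GenFlipThesisOfSubs` (stmt-ValiantsHypothesis-18306):
# the glue of the typed split of the deciding crux `GenFlipThesis ⇐ PerGenDegreeSuperQP ∧ PowGenDegreeQP`

`GenFlipThesisOfSubs := PerGenDegreeSuperQP → PowGenDegreeQP → GenFlipThesis` (crux-strategist BC2
redirect, route rev 3).  Proof by DEGREE OVERFLOW through the landed inheritance theorem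
`genInheritance_proof` (item 11659; helper files `GeneratorObstructionsGenInheritance{,Base,Upper}.lean`):
K2 at `c` gives the trace-side exponent `c₀`; K1 at exponent `c₀` beyond `max m₀ 1` gives `m` and a
generator type `χ` of `per_m` (own variables) with `m · 2^((log₂ m + c₀)^c₀) < -|χ|`; for each `e` in the
window, inheritance transports `χ` to a generator type `χ'` of the block-placed `per_m` with `|χ'| = |χ|`,
so `γ_χ'(per_m) ≥ 1`; were `γ_χ'(per_m) ≤ γ_χ'(tr X^m)`, the trace side would have a generator of type
`χ'` and K2's bound `-|χ'| ≤ m · 2^((log₂ m + c₀)^c₀)` contradicts K1's.  (= the proved support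
`CruxesToThesis`, item 11662, with its `GenInheritance` hypothesis discharged.)
Candidate proof by the planner (crux-strategist seat); to be landed verbatim by a prover with
`--workitem stmt-ValiantsHypothesis-18306`.
-/

-- `Summit.ValiantsHypothesis.ValiantsHypothesis.…` is the tree's mandated single-conjunct layout
-- (Sub = Summit), so the duplicated namespace component is intended.
set_option linter.dupNamespace false

namespace Summit.ValiantsHypothesis.ValiantsHypothesis.Theorems.GeneratorObstructions

open Summit.ValiantsHypothesis.ValiantsHypothesis.Theses.GeneratorObstructions

/-- **`GenFlipThesisOfSubs` holds** (item stmt-ValiantsHypothesis-18306 of route GeneratorObstructions):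
`PerGenDegreeSuperQP → PowGenDegreeQP → GenFlipThesis`, by degree overflow through the landed
inheritance theorem `genInheritance_proof`. [folklore] -/
theorem genFlipThesisOfSubs_proof :
    Summit.ValiantsHypothesis.ValiantsHypothesis.Theses.GeneratorObstructions.GenFlipThesisOfSubs := by
  unfold Summit.ValiantsHypothesis.ValiantsHypothesis.Theses.GeneratorObstructions.GenFlipThesisOfSubs
  intro hK1 hK2 c m₀
  -- trace side: the generation exponent `c₀` valid throughout the window of constant `c`
  obtain ⟨c₀, hc₀⟩ := hK2 c
  -- permanent side: a late generator type `χ` at exponent `c₀`, for some `m ≥ max m₀ 1`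
  obtain ⟨m, hm, χ, hγ, hdeg⟩ := hK1 c₀ (max m₀ 1)
  have hm₀ : m₀ ≤ m := le_trans (le_max_left _ _) hm
  have h1m : 1 ≤ m := le_trans (le_max_right _ _) hm
  refine ⟨m, hm₀, h1m, fun e he => ?_⟩
  -- inheritance (landed theorem, item 11659): `χ` survives the block placement with the same size
  obtain ⟨χ', hsize, hγ'⟩ :=
    Summit.ValiantsHypothesis.ValiantsHypothesis.Theorems.genInheritance_proof m e h1m χ hγ
  refine ⟨χ', lt_of_not_ge fun hle => ?_⟩
  -- overflow: a trace-side generator of type `χ'` would sit below K2's bound, but `|χ'| = |χ|`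
  have hne := (Nat.lt_of_lt_of_le (Nat.pos_of_ne_zero hγ') hle).ne'
  have hb := hc₀ m e h1m he χ' hne
  rw [hsize] at hb
  exact absurd (lt_of_lt_of_le hdeg hb) (lt_irrefl _)

end Summit.ValiantsHypothesis.ValiantsHypothesis.Theorems.GeneratorObstructions
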